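import Summits.Ventures.HSemireg.WeilFrameRealCarrierDegrees
import Summits.Ventures.HSemireg.WedgeCarrierMukaiPairing

/-!
# Venture HSemireg — the MUKAI PAIRING WITHOUT A FRAME and ON THE REAL CARRIER: the degree-`4n` part of `v^∨ · v` is
# `(P_f(q) + 2·(-1)ⁿ t) · ĥ^{2n}/(2n)!` for `v = Σ (q_m/m!) ĥ^m + ĉ₊ + ĉ₋` with pin `(2n)!·ĉ₊ĉ₋ = t·ĥ^{2n}`

HONEST FRAMING. Part of the Lean index of the computation cell `pub-hsemireg` (seat w3-mod4-1 gen 9, W3 SPECIAL FIBRES,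
MOD4-OFFSPLIT §1 LEMMA HRR-SPLIT / §13). Finite-dimensional exterior / linear algebra plus the tree's real carriers and the
Literature's Weil-type layer ONLY: no semiregularity map, no Ext group, no Euler characteristic of any sheaf, no integral `∫` is
constructed; nothing here says that HC / HC_CM / HC_AV holds; nothing here is a claim about any explicit variety; no Literature fact
is declared; NO definition is introduced. NOT formalised: the reading `∫ ĥ^{2n}/(2n)! = D` (so that the number below becomes
`χ_HRR(v) = D·(P_f(q) + 2(-1)ⁿt) = D·P_f(q) + (w,w)_χ`) and the Hodge–Riemann sign `(w,w)_χ > 0`.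

WHAT IS PROVED (characteristic `0`). `WedgeCarrierMukaiPairing.proj_mukaiDual_mul_top` (gen 9, FILE 19) in an adapted frame;
here WITHOUT a frame: **`proj_mukaiDual_mul_top_weilDatum`** — for a Weil datum `(V; L; P, Q; Θ)` of type `(n,n)`, `n ≥ 1`, non-zero
Weil vectors `w± ∈ topLine`, the class `v = Σ_{m ≤ 2n} (q_m/m!) Θ^m + w₊ + w₋`, its Mukai dual vector
`v^∨ = Σ_{m ≤ 2n} ((-1)^m q_m/m!) Θ^m + (-1)ⁿ (w₊ + w₋)` and the pin `(2n)!·(w₊ w₋) = t·Θ^{2n}`: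
`proj_{4n} (v^∨ · v) = ((Σ_{j ≤ 2n} (-1)^j C(2n,j) q_j q_{2n-j} + 2·(-1)ⁿ t) / (2n)!) · Θ^{2n}`; and ON THE REAL CARRIER
**`proj_mukaiDual_mul_top_weilType`** — the same for `A : AbelianVariety ℂ` of dimension `2n`, `φ ≫ φ = -(d • 𝟙 A)`, `d ≥ 1`,
`P, Q` the `±i√d`-eigenspaces, `dim (P ⊓ H^{1,0}) = n`, `h` `K`-symmetric of type `(1,1)` with `ĥ^{2n} ≠ 0`, non-zero `c± ∈ E±`,
pin `(2n)!·(ĉ₊ ĉ₋) = t·ĥ^{2n}` (the SAME `t` as in `finrank_S_weilType_middle`): the degree-`4n` component of `v^∨ · v` in `ΛH¹(A)` is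
`((P_f(q) + 2·(-1)ⁿ t)/(2n)!) · ĥ^{2n}`. So the MOD-4 line's two numbers — the rank table (FILES 13–15) and the HRR density — are
read off the same class with the same pin `t`. Everything PROVED, 0 sorry.
References: [BourbakiAlgebre1a3] Ch. III §7 no. 8; [MumfordAV1970] §16; [BuchweitzFlenner2008HH] Prop. 6.4.4; [vanGeemen1994HodgeAV] 4.9.
-/

noncomputable section

open CliffordAlgebra (contractLeft)
open ExteriorAlgebra (ι)
open Module CategoryTheory
open Literature.AlgebraicGeometry.Motives Literature.AlgebraicGeometry.HodgeTheory
open Literature.AlgebraicTopology.SingularHomology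

namespace Summit.Ventures.HSemireg.WeilFrame

open Summit.Ventures.HSemireg.WedgeBridge Summit.Ventures.HSemireg.WeilCarrier Summit.Ventures.HSemireg.Mod4Carrier

/-! ### 1. For a Weil datum (no frame) -/

section Datum

variable {K : Type*} [Field K] {V : Type*} [AddCommGroup V] [Module K V]

/-- **MUKAI PAIRING OF A MOD-4 CLASS, NO FRAME** (Weil datum of type `(n,n)`, `n ≥ 1`, char `0`): with
`v = Σ (q_m/m!) Θ^m + w₊ + w₋`, `v^∨ = Σ ((-1)^m q_m/m!) Θ^m + (-1)ⁿ(w₊ + w₋)` and `(2n)!·(w₊ w₋) = t·Θ^{2n}`: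
`proj_{4n}(v^∨ · v) = ((Σ_j (-1)^j C(2n,j) q_j q_{2n-j} + 2(-1)ⁿ t)/(2n)!) · Θ^{2n}`.
[cite: BourbakiAlgebre1a3, Ch. III §7 no. 8] [cite: MumfordAV1970, §16] -/
theorem proj_mukaiDual_mul_top_weilDatum [FiniteDimensional K V] [CharZero K] {n : ℕ} {L P Q : Submodule K V}
    {Θ wP wQ : ExteriorAlgebra K V} (hV : finrank K V = (n + n) + (n + n)) (hPQ : Disjoint P Q)
    (hL : finrank K L = n + n) (hLQ : finrank K ↥(L ⊓ Q) = n) (hLP : finrank K ↥(L ⊓ P) = n)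
    (hP : finrank K ↥P = n + n) (hQ : finrank K ↥Q = n + n) (hΘ : Θ ∈ Submodule.span K
      {z : ExteriorAlgebra K V | ∃ x l : V, ((x ∈ P ∧ l ∈ L ⊓ Q) ∨ (x ∈ Q ∧ l ∈ L ⊓ P)) ∧ z = ι K x * ι K l})
    (hnd : ∀ l ∈ (L : Set V), ι K l ∈ Submodule.span K {y : ExteriorAlgebra K V |
      ∃ φ ∈ {θ : Module.Dual K V | ∀ q ∈ L, θ q = 0}, y = contractLeft φ Θ})
    (hwP : wP ∈ ((⋀[K]^(finrank K ↥P) ↥P).map (ExteriorAlgebra.map P.subtype).toLinearMap)) (hwP0 : wP ≠ 0)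
    (hwQ : wQ ∈ ((⋀[K]^(finrank K ↥Q) ↥Q).map (ExteriorAlgebra.map Q.subtype).toLinearMap)) (hwQ0 : wQ ≠ 0) (hn : 1 ≤ n)
    (q : ℕ → K) {t : K} (ht : (((n + n).factorial : ℕ) : K) • (wP * wQ) = t • Θ ^ (n + n)) :
    GradedAlgebra.proj (fun i : ℕ => ⋀[K]^i V) ((n + n) + (n + n))
        (((∑ m ∈ Finset.range (n + n + 1), (((-1 : K) ^ m * q m) * ((m.factorial : ℕ) : K)⁻¹) • Θ ^ m) +
            (-1 : K) ^ n • (wP + wQ)) *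
          ((∑ m ∈ Finset.range (n + n + 1), (q m * ((m.factorial : ℕ) : K)⁻¹) • Θ ^ m) + wP + wQ)) =
      (((∑ j ∈ Finset.range (n + n + 1), (-1 : K) ^ j * (((n + n).choose j : ℕ) : K) * (q j * q (n + n - j))) +
          2 * ((-1 : K) ^ n * t)) * ((((n + n).factorial : ℕ) : K)⁻¹)) • Θ ^ (n + n) := by
  obtain ⟨bV, a, b, -, -, -, hT, rfl, rfl, hE⟩ :=
    exists_frame_of_weilDatum hV hPQ hL hLQ hLP hP hQ hΘ hnd hwP hwP0 hwQ hwQ0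
  have hfac : (((n + n).factorial : ℕ) : K) ≠ 0 := Nat.cast_ne_zero.mpr (Nat.factorial_ne_zero _)
  -- the pin in the frame: `t = (-1)ⁿ ab`
  have ht' : (a • wUp bV n) * (b • wLow bV n) = t • LMprod bV (n + n) := by
    apply smul_right_injective (ExteriorAlgebra K V) hfac
    dsimp only
    rw [ht, smul_comm, factorial_smul_LMprod_eq_pow, hT]
  have htab : t = (-1 : K) ^ n * (a * b) := eq_of_smul_wUp_mul_smul_wLow bV (Nat.le_add_right n n) ht'
  have h2 : 2 * ((-1 : K) ^ n * t) = 2 * (a * b) := by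
    rw [htab, ← mul_assoc ((-1 : K) ^ n), ← pow_add, ← two_mul, pow_mul, neg_one_sq, one_pow, one_mul]
  have hpow : Θ ^ (n + n) = (((n + n).factorial : ℕ) : K) • LMprod bV (n + n) := by
    rw [hT, factorial_smul_LMprod_eq_pow]
  rw [hE (fun m => (-1 : K) ^ m * q m), hE q, proj_mukaiDual_mul_top bV hn q a b, h2, hpow, smul_smul, mul_assoc,
    inv_mul_cancel₀ hfac, mul_one]

end Datum

/-! ### 2. On the real carrier `ΛH¹(A)` -/

section RealCarrier

variable {A : AbelianVariety ℂ}

/-- **MUKAI PAIRING OF A MOD-4 CLASS ON THE REAL CARRIER** (`n ≥ 1`): for `A` of dimension `2n`, `φ ≫ φ = -(d • 𝟙 A)`, `d ≥ 1`,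
`P, Q` the `±i√d`-eigenspaces, `dim (P ⊓ H^{1,0}) = n`, `h` `K`-symmetric of type `(1,1)` with `ĥ^{2n} ≠ 0`, non-zero `c± ∈ E±`,
and the pin `(2n)!·(ĉ₊ · ĉ₋) = t·ĥ^{2n}`: with `v = Σ (q_m/m!) ĥ^m + ĉ₊ + ĉ₋` and `v^∨ = Σ ((-1)^m q_m/m!) ĥ^m + (-1)ⁿ(ĉ₊ + ĉ₋)`,
the degree-`4n` component of `v^∨ · v` in `ΛH¹(A)` is `((Σ_j (-1)^j C(2n,j) q_j q_{2n-j} + 2(-1)ⁿ t)/(2n)!) · ĥ^{2n}`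
(«`χ_HRR(v) = D·P_f(q) + (w,w)_χ`» before `∫`). [cite: MumfordAV1970, §16] [cite: vanGeemen1994HodgeAV, 4.9 and Lemma 5.2] -/
theorem proj_mukaiDual_mul_top_weilType (hA : IsSmoothProjective A.dim A.X) {n d : ℕ} (hdim : A.dim = n + n) (hd : 0 < d)
    {φ : A ⟶ A} (hφ : φ ≫ φ = -(d • 𝟙 A)) {P Q : Submodule ℂ (complexBetti A.X 1)}
    (hP : P = Module.End.eigenspace (complexBetti.map φ.hom.hom.hom 1).hom (Complex.I * (Real.sqrt d : ℂ)))
    (hQ : Q = Module.End.eigenspace (complexBetti.map φ.hom.hom.hom 1).hom (-(Complex.I * (Real.sqrt d : ℂ))))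
    (hp : finrank ℂ ↥(P ⊓ hodgeOneZero hA) = n) {h : complexBetti A.X 2}
    (hh : complexBetti.map φ.hom.hom.hom 2 h = (d : ℂ) • h) (h11 : IsOfHodgeType A.dim A.X 2 1 1 h)
    (hvol : ((⋀[ℂ]^2 (complexBetti A.X 1)).subtype ((abelianVarietyCohomologyExteriorH1_holds.equiv A 2).symm h)) ^ (n + n) ≠ 0)
    {cP cQ : complexBetti A.X (2 * n)} (hcP : cP ∈ weilClassesPlus A φ n d) (hcP0 : cP ≠ 0)
    (hcQ : cQ ∈ weilClassesMinus A φ n d) (hcQ0 : cQ ≠ 0) (hn : 1 ≤ n) (q : ℕ → ℂ) {t : ℂ}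
    (ht : (((n + n).factorial : ℕ) : ℂ) •
        ((⋀[ℂ]^(2 * n) (complexBetti A.X 1)).subtype ((abelianVarietyCohomologyExteriorH1_holds.equiv A (2 * n)).symm cP) *
          (⋀[ℂ]^(2 * n) (complexBetti A.X 1)).subtype ((abelianVarietyCohomologyExteriorH1_holds.equiv A (2 * n)).symm cQ)) =
      t • ((⋀[ℂ]^2 (complexBetti A.X 1)).subtype ((abelianVarietyCohomologyExteriorH1_holds.equiv A 2).symm h)) ^ (n + n)) :
    GradedAlgebra.proj (fun i : ℕ => ⋀[ℂ]^i (complexBetti A.X 1)) ((n + n) + (n + n))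
        (((∑ m ∈ Finset.range (n + n + 1), (((-1 : ℂ) ^ m * q m) * ((m.factorial : ℕ) : ℂ)⁻¹) •
              ((⋀[ℂ]^2 (complexBetti A.X 1)).subtype ((abelianVarietyCohomologyExteriorH1_holds.equiv A 2).symm h)) ^ m) +
            (-1 : ℂ) ^ n •
              ((⋀[ℂ]^(2 * n) (complexBetti A.X 1)).subtype ((abelianVarietyCohomologyExteriorH1_holds.equiv A (2 * n)).symm cP) +
                (⋀[ℂ]^(2 * n) (complexBetti A.X 1)).subtype ((abelianVarietyCohomologyExteriorH1_holds.equiv A (2 * n)).symm cQ))) *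
          ((∑ m ∈ Finset.range (n + n + 1), (q m * ((m.factorial : ℕ) : ℂ)⁻¹) •
              ((⋀[ℂ]^2 (complexBetti A.X 1)).subtype ((abelianVarietyCohomologyExteriorH1_holds.equiv A 2).symm h)) ^ m) +
            (⋀[ℂ]^(2 * n) (complexBetti A.X 1)).subtype ((abelianVarietyCohomologyExteriorH1_holds.equiv A (2 * n)).symm cP) +
            (⋀[ℂ]^(2 * n) (complexBetti A.X 1)).subtype ((abelianVarietyCohomologyExteriorH1_holds.equiv A (2 * n)).symm cQ))) =
      (((∑ j ∈ Finset.range (n + n + 1), (-1 : ℂ) ^ j * (((n + n).choose j : ℕ) : ℂ) * (q j * q (n + n - j))) +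
          2 * ((-1 : ℂ) ^ n * t)) * ((((n + n).factorial : ℕ) : ℂ)⁻¹)) •
        ((⋀[ℂ]^2 (complexBetti A.X 1)).subtype ((abelianVarietyCohomologyExteriorH1_holds.equiv A 2).symm h)) ^ (n + n) := by
  haveI : Module.Finite ℂ (complexBetti A.X 1) := abelianVarietyCohomologyExteriorH1_holds.finite_one A
  obtain ⟨hV, hPQ, hL, hLQ, hLP, hP2, hQ2⟩ := weilBlocks_of_sq_eq_neg hA hdim hd hφ hP hQ hp
  exact proj_mukaiDual_mul_top_weilDatum hV hPQ hL hLQ hLP hP2 hQ2 (exteriorOf_mem_span_weilGen hA hd hφ hP hQ hh h11)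
    (hnd_of_polarisation_pow_ne_zero hA hdim hd hφ hP hQ hh h11 hvol)
    (exteriorOf_mem_topLine_of_mem_weilClassesPlus hdim hd hφ hP hcP) (exteriorOf_ne_zero hcP0)
    (exteriorOf_mem_topLine_of_mem_weilClassesMinus hdim hd hφ hQ hcQ) (exteriorOf_ne_zero hcQ0) hn q ht

end RealCarrier

end Summit.Ventures.HSemireg.WeilFrame

end
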